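import Literature.Geometry.Lorentzian.PseudoRiemannianMetric
import Literature.Geometry.Lorentzian.LeviCivita
import Literature.Geometry.Lorentzian.Volume
import Literature.Geometry.Lorentzian.EnergyCurrents
import Literature.Geometry.Riemannian.RiemannianDistance
import Literature.Geometry.Riemannian.IsotropicCurvature
import HarnessLib

/-!
# Chen–Zhu 2014, Cor. 2.2 and §3: a positive isotropic Yamabe form yields a conformal metric of
# positive isotropic curvature (dimension four)
(topic `Geometry/Riemannian`)

ONE named fact (a theorem in print, `def … : Prop`, D-0014) and its PROVED specialisation to the
verbatim statement of route item `ConformalPic` of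
`Summit.SmoothPoincare4.SmoothPoincare4.Theses.IsotropicCorkBracketing` (item
`stmt-SmoothPoincare4-9827`; cite item `wi-20011`).

## The source (held: arXiv:1206.5051, READ pp. 6–9)

B.-L. Chen, X.-P. Zhu, *A conformally invariant classification theorem in four dimensions*, Comm.
Anal. Geom. 22 (2014) 811–831:

* §2, (2.8) (PDF p. 6): for a nonnegative `O(n)`-invariant degree-one function `f` of the Weyl
  operator and `ĝ = u^{4/(n−2)} g`, "`R_ĝ − f(W_ĝ) = u^{−(n+2)/(n−2)} [−4((n−1)/(n−2)) Δu +
  (R_g − f(W_g)) u]`, and hence `∫(R_ĝ − f(W_ĝ)) dv_ĝ / (∫ dv_ĝ)^{1−2/n} = ∫_M ((R_g − f(W_g)) u² +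
  4((n−1)/(n−2)) |∇u|²) dv_g / (∫ u^{2n/(n−2)} dv_g)^{(n−2)/n}`"; the generalized Yamabe constant
  `𝒴_f(Mⁿ, 𝒞) = inf_{g ∈ 𝒞} ℱ_f(Mⁿ, g)` of the conformal class `𝒞`.
* **Corollary 2.2** (PDF p. 7; "which was earlier obtained in [GLe] (see Proposition 3 in
  [GLe])" = Gursky–LeBrun 1998): "If `𝒴_f(Mⁿ, 𝒞) > 0`, then there exists `g̃ ∈ 𝒞` such that
  `R_g̃ − f(W_g̃) > 0`."
* **§3, first paragraph and proof of Thm. 1.1** (PDF p. 9): in dimension `4`,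
  `f(W_g) = 6 max{λ_max(W₊), λ_max(W₋)}`, `σ_g = R_g − 6 max{λ_max(W₊), λ_max(W₋)}`; "there
  exists a `g ∈ 𝒞` such that `σ_g > 0`. Since both `W₊` and `W₋` are of trace free, this implies
  the sum of least two eigenvalues of `R_g/12 + W±` is positive. In other words, `(M⁴, g)` has
  positive isotropic curvature" (Hamilton 1997, §1.2, Lemma 2.1; Micallef–Wang 1993).

## Rendering (the hypothesis of the route, and why it is Chen–Zhu's)

The route types the positivity of Chen–Zhu's isotropic Yamabe functional through the tree's
frame-wise `isotropicCurvature` (`K(e) = K₁₃ + K₁₄ + K₂₃ + K₂₄ − 2R₁₂₃₄` on a `G`-orthonormal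
4-frame, `IsotropicCurvature.lean`) rather than through `σ_G`: by Hamilton 1997, §1.2 (p. 5:
`K(P) = A₂₂ + A₃₃` with `A = 2(W₊ + R/12)` in Hamilton's basis `φᵢ` of `Λ²₊`, of squared norm `2`;
`CurvatureDecomposition.lean`) the minimum of `K(e)` over orthonormal frames at `x` is
`a₁ + a₂ ∧ c₁ + c₂ = (R − 6 max{λ_max W₊, λ_max W₋})/3 = σ_G(x)/3` (round `S⁴`: `K ≡ 4`,
`σ = 12`). The HYPOTHESIS is: for some `c > 0` and some continuous `μ : M → ℝ` with
`μ(x) ≤ K(e)` for every orthonormal 4-frame `e` at `x` (so `3μ ≤ σ_G` pointwise), the quadratic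
form `Q(u) = ∫_M (6|∇u|²_G + 3μu²) dV_G` — Chen–Zhu's numerator (2.8) at `n = 4`
(`4(n−1)/(n−2) = 6`) with `σ_G` replaced by its lower bound `3μ` — satisfies `c∫u² dV_G ≤ Q(u)` for
all `u ∈ C¹(M)`. Since `∫(6|∇u|² + σ_G u²) ≥ Q(u) ≥ c‖u‖²_{L²}`, and
`‖∇u‖²_{L²} ≤ (Q(u) + ‖σ_G‖_∞ ‖u‖²_{L²})/6 ≤ Q(u)(1 + ‖σ_G‖_∞/c)/6`, the Sobolev inequality
`‖u‖²_{L⁴} ≤ C_S(‖∇u‖²_{L²} + ‖u‖²_{L²})` on the compact `(M⁴, G)` (Aubin) gives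
`∫(6|∇u|² + σ_G u²) dV_G ≥ c' (∫u⁴ dV_G)^{1/2}` for all smooth `u > 0`, i.e.
`𝒢𝒴(M⁴, [G]) = 𝒴_f(M⁴, 𝒞_G) ≥ c' > 0` (the sign of a Yamabe-type constant is the sign of the bottom
of the spectrum of its conformal operator `−6Δ + σ`). Cor. 2.2 then supplies `g̃ = u²G ∈ 𝒞_G`
(`u` smooth positive) with `σ_g̃ > 0`, and §3 ¶1 makes `g̃` a metric of positive isotropic
curvature (`HasPositiveIsotropicCurvature`, the frame condition of `IsotropicCurvature.lean`, which
is Hamilton's/Micallef–Wang's PIC, `hamilton_positiveIsotropicCurvature_iff_blocks`). The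
CONCLUSION records the conformal metric `G' = u²G` (smooth `u > 0`), Riemannian and PIC; the
route item keeps only "there is a Riemannian PIC metric" (`chenZhu_pic_of_isotropicFormPos`,
proved from the fact by forgetting `u`).

Everything quantified as in the route: closed (compact, boundaryless, Hausdorff, second countable)
smooth 4-manifolds modelled on `EuclideanSpace ℝ (Fin 4)` with their Borel σ-algebra, a smooth
Riemannian `G` in the tree's `PseudoRiemannianMetric` form with `[G.HasLeviCivita]` (so that
`G.leviCivita` is its Levi-Civita connection), `gradSq` (`|∇u|²_G = G⁻¹(du, du)`,
`EnergyCurrents.lean`), the Riemannian measure `riemannianMeasure (G.toContMDiffRiemannianMetric hG)`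
(`Volume.lean`, `RiemannianDistance.lean`), `C¹` test functions (`ContMDiff (𝓡 4) 𝓘(ℝ, ℝ) 1 u`).
Not vendored: the invariants `𝒴_f`, `𝒢𝒴` themselves, Lemma 2.1 (solution of the generalized Yamabe
problem), Thm. 1.1 (the classification, which needs Chen–Tang–Zhu 2012).

## References

* B.-L. Chen, X.-P. Zhu, Comm. Anal. Geom. 22 (2014) 811–831 = arXiv:1206.5051, §2 (2.8),
  Lemma 2.1, Cor. 2.2; §3, first paragraph and proof of Thm. 1.1. [ChenZhu2014]
* M. J. Gursky, C. LeBrun, *Yamabe invariants and Spinᶜ structures*, GAFA 8 (1998) 965–977,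
  Prop. 3 (the earlier source of Cor. 2.2, as attributed by Chen–Zhu). [GurskyLebrun1998]
* R. S. Hamilton, *Four-manifolds with positive isotropic curvature*, Comm. Anal. Geom. 5 (1997)
  1–92, §1.2, p. 5 (`K(P) = A₂₂ + A₃₃`), Lemma 2.1. [Hamilton1997]
* M. Micallef, M. Wang, *Metrics with nonnegative isotropic curvature*, Duke Math. J. 72 (1993)
  649–672. [MicallefWang1993]
* T. Aubin, *Nonlinear analysis on manifolds. Monge–Ampère equations* (1982), Ch. 2 (Sobolev
  inequality on compact manifolds). [Aubin1982]
-/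

noncomputable section

open Bundle MeasureTheory
open scoped Manifold ContDiff Topology

namespace Literature.Geometry.Riemannian

open Lorentzian Lorentzian.PseudoRiemannianMetric

/-- **Chen–Zhu 2014, Cor. 2.2 with §3 ¶1** (= Gursky–LeBrun 1998, Prop. 3), in dimension four
and in the frame-wise isotropic form of route `SmoothPoincare4/IsotropicCorkBracketing`: on a
closed smooth 4-manifold `M`, let `G` be a smooth Riemannian metric such that, for some `c > 0`
and some continuous `μ : M → ℝ` bounding from below the isotropic curvatures
`K(e) = K₁₃ + K₁₄ + K₂₃ + K₂₄ − 2R₁₂₃₄` of `G` on all `G`-orthonormal 4-frames (hence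
`3μ ≤ σ_G = R_G − 6 max{λ_max W₊, λ_max W₋}`, Hamilton 1997 §1.2), the isotropic Yamabe form
dominates `L²`: `c ∫_M u² dV_G ≤ ∫_M (6 |∇u|²_G + 3 μ u²) dV_G` for every `u ∈ C¹(M)` — Chen–Zhu's
(2.8) at `n = 4` with `σ_G` replaced by `3μ`, which forces `𝒢𝒴(M⁴, [G]) > 0` (Sobolev inequality
on the compact `(M, G)`). THEN ("If `𝒴_f(Mⁿ, 𝒞) > 0`, then there exists `g̃ ∈ 𝒞` such that
`R_g̃ − f(W_g̃) > 0`", Cor. 2.2; "`σ_g > 0` … implies the sum of least two eigenvalues of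
`R_g/12 + W±` is positive. In other words, `(M⁴, g)` has positive isotropic curvature", §3) there
is a smooth positive `u : M → ℝ` such that the conformal metric `G' = u² G` is a Riemannian metric
of positive isotropic curvature (`HasPositiveIsotropicCurvature`: `K(e) > 0` on every orthonormal
4-frame for its Levi-Civita connection). See the module docstring for the assembly of the typed
hypothesis onto the printed one. [cite: ChenZhu2014, Cor. 2.2, (2.8) and §3 (first paragraph)]
[cite: GurskyLebrun1998, Prop. 3] [cite: Hamilton1997, §1.2, p. 5 and Lemma 2.1] -/
def chenZhu_conformalPic_of_isotropicFormPos : Prop :=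
  ∀ (M : Type) [TopologicalSpace M] [T2Space M] [SecondCountableTopology M]
    [ChartedSpace (EuclideanSpace ℝ (Fin 4)) M] [IsManifold (𝓡 4) ∞ M] [CompactSpace M]
    [MeasurableSpace M] [BorelSpace M]
    (G : PseudoRiemannianMetric (𝓡 4) ∞ (EuclideanSpace ℝ (Fin 4)) (TangentSpace (𝓡 4) : M → Type _))
    (hG : G.IsRiemannian) [G.HasLeviCivita],
    (∃ c : ℝ, 0 < c ∧ ∃ μ : M → ℝ, Continuous μ ∧
        (∀ (x : M) (e : Fin 4 → TangentSpace (𝓡 4) x), G.IsOrthonormalFrame x e →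
          μ x ≤ G.isotropicCurvature G.leviCivita x e) ∧
        ∀ u : M → ℝ, ContMDiff (𝓡 4) 𝓘(ℝ, ℝ) 1 u →
          c * ∫ x, u x ^ 2 ∂(riemannianMeasure (G.toContMDiffRiemannianMetric hG)) ≤
            ∫ x, (6 * G.gradSq u x + 3 * μ x * u x ^ 2)
              ∂(riemannianMeasure (G.toContMDiffRiemannianMetric hG))) →
    ∃ u : M → ℝ, ContMDiff (𝓡 4) 𝓘(ℝ, ℝ) ∞ u ∧ (∀ x, 0 < u x) ∧
      ∃ G' : PseudoRiemannianMetric (𝓡 4) ∞ (EuclideanSpace ℝ (Fin 4))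
          (TangentSpace (𝓡 4) : M → Type _),
        (∀ (x : M) (v w : TangentSpace (𝓡 4) x), G'.val x v w = u x ^ 2 * G.val x v w) ∧
          G'.IsRiemannian ∧ G'.HasPositiveIsotropicCurvature

/-- **Route form** (verbatim the statement of item `ConformalPic` of route
`SmoothPoincare4/IsotropicCorkBracketing`, `stmt-SmoothPoincare4-9827`): under the same
hypotheses there EXISTS a Riemannian metric of positive isotropic curvature on `M` — namely the
conformal metric `u²G` of `chenZhu_conformalPic_of_isotropicFormPos`, forgetting the conformal
factor. [cite: ChenZhu2014, Cor. 2.2 and §3 (first paragraph)] -/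
theorem chenZhu_pic_of_isotropicFormPos (h : chenZhu_conformalPic_of_isotropicFormPos) :
    ∀ (M : Type) [TopologicalSpace M] [T2Space M] [SecondCountableTopology M]
      [ChartedSpace (EuclideanSpace ℝ (Fin 4)) M] [IsManifold (𝓡 4) ∞ M] [CompactSpace M]
      [MeasurableSpace M] [BorelSpace M]
      (G : PseudoRiemannianMetric (𝓡 4) ∞ (EuclideanSpace ℝ (Fin 4)) (TangentSpace (𝓡 4) : M → Type _))
      (hG : G.IsRiemannian) [G.HasLeviCivita],
      (∃ c : ℝ, 0 < c ∧ ∃ μ : M → ℝ, Continuous μ ∧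
          (∀ (x : M) (e : Fin 4 → TangentSpace (𝓡 4) x), G.IsOrthonormalFrame x e →
            μ x ≤ G.isotropicCurvature G.leviCivita x e) ∧
          ∀ u : M → ℝ, ContMDiff (𝓡 4) 𝓘(ℝ, ℝ) 1 u →
            c * ∫ x, u x ^ 2 ∂(riemannianMeasure (G.toContMDiffRiemannianMetric hG)) ≤
              ∫ x, (6 * G.gradSq u x + 3 * μ x * u x ^ 2)
                ∂(riemannianMeasure (G.toContMDiffRiemannianMetric hG))) →
      ∃ G' : PseudoRiemannianMetric (𝓡 4) ∞ (EuclideanSpace ℝ (Fin 4))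
          (TangentSpace (𝓡 4) : M → Type _),
        G'.IsRiemannian ∧ G'.HasPositiveIsotropicCurvature := by
  intro M _ _ _ _ _ _ _ _ G hG _ hyp
  obtain ⟨_, _, _, G', _, hR, hP⟩ := h M G hG hyp
  exact ⟨G', hR, hP⟩

end Literature.Geometry.Riemannian

end
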